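import Summits.BirchSwinnertonDyer.Rank1Residual.Additive.LocalTorsionAdditiveFiveSevenShort
import HarnessLib

/-!
# No `p`-torsion in `E(ℚ_p)` at an ADDITIVE prime `p ≥ 5` — except on `v₅(c₄) = 1` (`p = 5`,
# Kodaira II/III) and `v₇(c₆) = 1` (`p = 7`, Kodaira II): arbitrary minimal model, and the exact
# exceptional locus

HONEST FRAMING (cell `b2b-bsdres`, run/shared/lean/b2b/bsd-rank1-residual/, verbatim in every
file): the goal of the cell is to DELETE the COMBINATION-SHAPED residual classes of the
Birch–Swinnerton-Dyer formula for ALL analytic-rank `≤ 1` elliptic curves over `ℚ` — "full BSD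
formula for every rank `≤ 1` curve in class `C`" assembled STRICTLY from published theorems — so
that the rank-`≤ 1` remainder becomes exactly the CONSTRUCTION-SHAPED classes, which are TYPED
(missing-input `Prop`s), NOT attempted. This is not "finishing BSD". Sub-cell `additive-p2`
(X3♯(G-ord) / X4♯(G-ord)), generation 37: research route; no claim beyond the stated classes;
TOOL theorems on local points only, no definition, no named fact, nothing booked, no label moved.

## What and why

`Additive/LocalTorsionAdditiveFiveSevenShort` proved, for the short minimal model
`y² = x³ + ax + b` over `ℚ_p` (`a, b ∈ pℤ_p`, `p ≥ 5`; `25 ∣ a` if `p = 5`, `49 ∣ b` if `p = 7`),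
that no point `P ≠ O` is killed by `p` (Mazur's Step 1 at `q = N`, `N ≥ 11` in the tree, pushed
down to `5` and `7` by the integer cusp expansions of `ψ₅`, `ψ₇`). This file transports it to an
ARBITRARY elliptic `W/ℚ_p` with additive minimal reduction (Mathlib's `toShortNF`, `u = 1`, so the
short model is still minimal with the same `c₄ = −48a`, `c₆ = −864b`):

* **`not_prime_zsmul_eq_zero_of_hasAdditiveReduction'`** — `p ≥ 5`, additive, `‖c₄(W)‖ < 5⁻¹`
  if `p = 5`, `‖c₆(W)‖ < 7⁻¹` if `p = 7` (no condition at `p ≥ 11`): no `P ≠ O` with `p • P = O`;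
* `norm_c₄_c₆_Δ_lt_one` — at an additive prime `‖c₄‖, ‖c₆‖, ‖Δ‖ < 1` (`c₆² = c₄³ − 1728Δ`);
* **`norm_c₄_or_norm_c₆_of_prime_zsmul_eq_zero`** — the EXCEPTIONAL LOCUS: `P ≠ O`, `p • P = O`
  on an additive minimal `W/ℚ_p`, `p ≥ 5` ⟹ `(p = 5 ∧ ‖c₄‖ = 5⁻¹)` (`v₅(c₄) = 1`: Kodaira II or
  III) `∨ (p = 7 ∧ ‖c₆‖ = 7⁻¹)` (`v₇(c₆) = 1`: Kodaira II). Both occur over `ℚ`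
  (`y² − 2xy − 3y = x³ − 3x²` ∈ `X₁(5)`, type II at `5`; `[−19, −100, −100, 0, 0]` ∈ `X₁(7)`,
  conductor `490`, type II at `7`).

The `ℚ`-curve consequences (`E(ℚ)[p] = 0`, `p ∤ #E(ℚ)_tors`, i.e. the `2·ord_p #E(ℚ)_tors` term
of every leading-term identity at an additive `p`) are drawn in `Additive/AdditiveTorsionFiveSeven`.

References: [Mazur1977] B. Mazur, *Modular curves and the Eisenstein ideal*, Publ. Math. IHÉS 47
(1977), Ch. III §5, Step 1, p. 158. [SilvermanAEC2009] VII.3.1, VII.5.1, Exercise 3.7;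
[SilvermanATAEC1994] Cor. IV.9.2(d). M. Flexor, J. Oesterlé, Astérisque 183 (1990) 25–36 (context).
-/

noncomputable section

open scoped Classical

namespace Summit.BirchSwinnertonDyer.Rank1Residual.Additive.CuspTorsion

open WeierstrassCurve Polynomial Literature.NumberTheory.EllipticCurves
  Literature.NumberTheory.EllipticCurves.CuspJets

variable {p : ℕ} [Fact p.Prime]

/-! ## §1 From an arbitrary additive minimal model: `c₄ = −48a`, `c₆ = −864b` -/

/-- `c₆` of `y² = x³ + ax + b` is `−864b`. [folklore] -/
theorem shortCurve_c₆ (A B : ℤ_[p]) : (shortCurve A B).c₆ = -864 * B := by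
  simp only [WeierstrassCurve.c₆, WeierstrassCurve.b₂, WeierstrassCurve.b₄, WeierstrassCurve.b₆]
  ring

/-- In `ℤ_p`, `‖z‖ < p⁻¹ ⟹ p² ∣ z`. [folklore] -/
theorem sq_dvd_of_norm_lt_inv {z : ℤ_[p]} (hz : ‖z‖ < (p : ℝ)⁻¹) : (p : ℤ_[p]) ^ 2 ∣ z := by
  rw [← Ideal.mem_span_singleton, ← PadicInt.norm_le_pow_iff_mem_span_pow]
  have h := (PadicInt.norm_lt_pow_iff_norm_le_pow_sub_one z (-1)).mp (by rwa [zpow_neg_one])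
  rw [show (-1 : ℤ) - 1 = -((2 : ℕ) : ℤ) by norm_num] at h
  exact h

/-- **Mazur's Step 1 at `q = N`, local form, extended to `N ∈ {5, 7}`**: over `ℚ_p`, `p ≥ 5`, an
elliptic curve whose minimal model has **additive** reduction, and whose `c₄` satisfies
`‖c₄‖ < 5⁻¹` when `p = 5` (i.e. `v₅(c₄) ≥ 2`: not Kodaira type II/III with `v₅(c₄) = 1`), resp.
whose `c₆` satisfies `‖c₆‖ < 7⁻¹` when `p = 7` (`v₇(c₆) ≥ 2`: not type II), has no `ℚ_p`-point
`P ≠ O` with `p • P = O`. For `p ≥ 11` there is no side condition (the tree's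
`not_prime_zsmul_eq_zero_of_hasAdditiveReduction`). The minimal integral model is brought to short
form by Mathlib's `toShortNF` (`u = 1`: same `c₄ = −48a`, `c₆ = −864b`, still minimal).
[cite: Mazur1977, Ch. III §5, Step 1, p. 158] -/
theorem not_prime_zsmul_eq_zero_of_hasAdditiveReduction' (hp5 : 5 ≤ p)
    (W : WeierstrassCurve ℚ_[p]) [W.IsElliptic] [hadd : W.HasAdditiveReduction ℤ_[p]]
    (h5 : p = 5 → ‖W.c₄‖ < (p : ℝ)⁻¹) (h7 : p = 7 → ‖W.c₆‖ < (p : ℝ)⁻¹)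
    {P : W.toAffine.Point} (hP0 : P ≠ 0) : (p : ℤ) • P ≠ 0 := by
  obtain ⟨h2, h3⟩ := norm_two_three (p := p) hp5
  haveI : Invertible (2 : ℤ_[p]) := (PadicInt.isUnit_iff.mpr h2).invertible
  haveI : Invertible (3 : ℤ_[p]) := (PadicInt.isUnit_iff.mpr h3).invertible
  have hc₄ := hadd.additiveReduction
  have hΔ := hadd.badReduction
  obtain ⟨W₀, hW₀⟩ : ∃ W₀ : WeierstrassCurve ℤ_[p], W = W₀.baseChange ℚ_[p] :=
    IsIntegral.integral
  subst hW₀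
  set D : VariableChange ℤ_[p] := W₀.toShortNF with hD
  have hDu : D.u = 1 := toShortNF_u W₀
  haveI hNF : (D • W₀).IsShortNF := WeierstrassCurve.toShortNF_spec W₀
  set A := (D • W₀).a₄ with hA'
  set B := (D • W₀).a₆ with hB'
  have hM : D • W₀ = shortCurve A B :=
    WeierstrassCurve.ext hNF.a₁ hNF.a₂ hNF.a₃ rfl rfl
  -- `c₄`, `c₆`, `Δ` are unchanged (`u = 1`) and equal those of `W` under `ℤ_p → ℚ_p`
  have ec₄ : (shortCurve A B).c₄ = W₀.c₄ := by
    rw [← hM, variableChange_c₄, hDu, inv_one, Units.val_one, one_pow, one_mul]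
  have ec₆ : (shortCurve A B).c₆ = W₀.c₆ := by
    rw [← hM, variableChange_c₆, hDu, inv_one, Units.val_one, one_pow, one_mul]
  have hn : ∀ z : ℤ_[p], ‖algebraMap ℤ_[p] ℚ_[p] z‖ = ‖z‖ := fun z => rfl
  have ec : (W₀.baseChange ℚ_[p]).c₄ = algebraMap ℤ_[p] ℚ_[p] W₀.c₄ :=
    map_c₄ W₀ (algebraMap ℤ_[p] ℚ_[p])
  have ec' : (W₀.baseChange ℚ_[p]).c₆ = algebraMap ℤ_[p] ℚ_[p] W₀.c₆ :=
    map_c₆ W₀ (algebraMap ℤ_[p] ℚ_[p])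
  have hc₄' : ‖(shortCurve A B).c₄‖ < 1 := by
    rw [ec₄]
    rw [ec, IsDedekindDomain.HeightOneSpectrum.valuation_lt_one_iff_mem] at hc₄
    exact PadicInt.mem_nonunits.mp hc₄
  have hΔ' : ‖(shortCurve A B).Δ‖ < 1 := by
    rw [← hM, variableChange_Δ, hDu, inv_one, Units.val_one, one_pow, one_mul]
    have eΔ : (W₀.baseChange ℚ_[p]).Δ = algebraMap ℤ_[p] ℚ_[p] W₀.Δ :=
      map_Δ W₀ (algebraMap ℤ_[p] ℚ_[p])
    rw [eΔ, IsDedekindDomain.HeightOneSpectrum.valuation_lt_one_iff_mem] at hΔ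
    exact PadicInt.mem_nonunits.mp hΔ
  obtain ⟨hA, hB⟩ := norm_lt_one_of_short (p := p) hp5 hc₄' hΔ'
  -- the side conditions: `‖c₄‖ < p⁻¹ ⟹ p² ∣ a`, `‖c₆‖ < p⁻¹ ⟹ p² ∣ b`
  have h5' : p = 5 → (p : ℤ_[p]) ^ 2 ∣ A := by
    intro hp
    have h := h5 hp
    rw [ec, hn, ← ec₄, (shortCurve_c₄_Δ A B).1,
      show (-48 : ℤ_[p]) * A = -(2 ^ 4 * 3 * A) by ring, norm_neg, norm_mul, norm_mul, norm_pow,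
      h2, h3, one_pow, one_mul, one_mul] at h
    exact sq_dvd_of_norm_lt_inv h
  have h7' : p = 7 → (p : ℤ_[p]) ^ 2 ∣ B := by
    intro hp
    have h := h7 hp
    rw [ec', hn, ← ec₆, shortCurve_c₆ A B,
      show (-864 : ℤ_[p]) * B = -(2 ^ 5 * 3 ^ 3 * B) by ring, norm_neg, norm_mul, norm_mul,
      norm_pow, norm_pow, h2, h3, one_pow, one_pow, one_mul, one_mul] at h
    exact sq_dvd_of_norm_lt_inv h
  -- the short model over `ℚ_p` and the transported point
  have hV : D.baseChange ℚ_[p] • W₀.baseChange ℚ_[p] = (shortCurve A B).baseChange ℚ_[p] := by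
    rw [← hM]
    exact map_variableChange W₀ D (algebraMap ℤ_[p] ℚ_[p])
  haveI : (D.baseChange ℚ_[p] • W₀.baseChange ℚ_[p]).IsMinimal ℤ_[p] :=
    IsMinimal.smul_baseChange (W₀.baseChange ℚ_[p]) D
  set e := VariableChange.pointEquiv (W₀.baseChange ℚ_[p]) (D.baseChange ℚ_[p])
  have hP1 : e P ≠ 0 := fun h0 => hP0 (e.injective (h0.trans e.map_zero.symm))
  intro hkill
  refine not_prime_zsmul_eq_zero_of_short' hp5 hA hB h5' h7' _ hV hP1 ?_
  rw [← map_zsmul e, hkill, map_zero]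

/-- **At an additive prime, `‖c₄‖ < 1`, `‖c₆‖ < 1`, `‖Δ‖ < 1`** for an (integral, minimal)
equation over `ℚ_p` with additive reduction (`c₄`, `Δ` by definition; `c₆` from
`c₆² = c₄³ − 1728Δ`). [cite: SilvermanAEC2009, VII.5 Prop. 5.1] -/
theorem norm_c₄_c₆_Δ_lt_one (W : WeierstrassCurve ℚ_[p]) [hadd : W.HasAdditiveReduction ℤ_[p]] :
    ‖W.c₄‖ < 1 ∧ ‖W.c₆‖ < 1 ∧ ‖W.Δ‖ < 1 := by
  obtain ⟨W₀, hW₀⟩ : ∃ W₀ : WeierstrassCurve ℤ_[p], W = W₀.baseChange ℚ_[p] :=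
    IsIntegral.integral
  subst hW₀
  have hn : ∀ z : ℤ_[p], ‖algebraMap ℤ_[p] ℚ_[p] z‖ = ‖z‖ := fun z => rfl
  have ec : (W₀.baseChange ℚ_[p]).c₄ = algebraMap ℤ_[p] ℚ_[p] W₀.c₄ :=
    map_c₄ W₀ (algebraMap ℤ_[p] ℚ_[p])
  have ec' : (W₀.baseChange ℚ_[p]).c₆ = algebraMap ℤ_[p] ℚ_[p] W₀.c₆ :=
    map_c₆ W₀ (algebraMap ℤ_[p] ℚ_[p])
  have eΔ : (W₀.baseChange ℚ_[p]).Δ = algebraMap ℤ_[p] ℚ_[p] W₀.Δ :=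
    map_Δ W₀ (algebraMap ℤ_[p] ℚ_[p])
  have hc₄lt : ‖(W₀.baseChange ℚ_[p]).c₄‖ < 1 := by
    have h := hadd.additiveReduction
    rw [ec, IsDedekindDomain.HeightOneSpectrum.valuation_lt_one_iff_mem] at h
    rw [ec, hn]
    exact PadicInt.mem_nonunits.mp h
  have hΔ : ‖(W₀.baseChange ℚ_[p]).Δ‖ < 1 := by
    have h' := hadd.badReduction
    rw [eΔ, IsDedekindDomain.HeightOneSpectrum.valuation_lt_one_iff_mem] at h'
    rw [eΔ, hn]
    exact PadicInt.mem_nonunits.mp h'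
  have hc₆le : ‖(W₀.baseChange ℚ_[p]).c₆‖ ≤ 1 := by
    rw [ec', hn]; exact PadicInt.norm_le_one _
  refine ⟨hc₄lt, ?_, hΔ⟩
  rcases hc₆le.lt_or_eq with h | h
  · exact h
  · exfalso
    have hrel : (W₀.baseChange ℚ_[p]).c₆ ^ 2 =
        (W₀.baseChange ℚ_[p]).c₄ ^ 3 + -(1728 * (W₀.baseChange ℚ_[p]).Δ) := by
      have := (W₀.baseChange ℚ_[p]).c_relation; linear_combination this
    have h1 : ‖(W₀.baseChange ℚ_[p]).c₆ ^ 2‖ < 1 := by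
      rw [hrel]
      refine (Padic.nonarchimedean _ _).trans_lt (max_lt ?_ ?_)
      · rw [norm_pow]; exact pow_lt_one₀ (norm_nonneg _) hc₄lt three_ne_zero
      · rw [norm_neg, norm_mul]
        refine mul_lt_one_of_nonneg_of_lt_one_right ?_ (norm_nonneg _) hΔ
        have : ‖((1728 : ℤ) : ℚ_[p])‖ ≤ 1 := Padic.norm_int_le_one 1728
        exact_mod_cast this
    rw [norm_pow, h, one_pow] at h1
    exact lt_irrefl _ h1

/-- In `ℚ_p`: `‖z‖ < 1` and not `‖z‖ < p⁻¹` force `‖z‖ = p⁻¹` (norms are powers of `p`).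
[folklore] -/
theorem norm_eq_inv_of_lt_one_of_not_lt_inv {z : ℚ_[p]} (hz1 : ‖z‖ < 1)
    (hzp : ¬ ‖z‖ < (p : ℝ)⁻¹) : ‖z‖ = (p : ℝ)⁻¹ := by
  have hp1 : (1 : ℝ) < p := by exact_mod_cast (Fact.out : p.Prime).one_lt
  have hz0 : z ≠ 0 := by
    rintro rfl
    exact hzp (by rw [norm_zero]; positivity)
  rw [Padic.norm_eq_zpow_neg_valuation hz0] at hz1 hzp ⊢
  rw [← zpow_neg_one]
  congr 1
  have h1 : -z.valuation < 0 := by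
    by_contra hle
    push Not at hle
    exact absurd (one_le_zpow₀ hp1.le hle) (not_le.mpr hz1)
  have h2 : ¬ -z.valuation < -1 := fun hlt =>
    hzp ((zpow_lt_zpow_iff_right₀ hp1).mpr hlt |>.trans_eq (zpow_neg_one _))
  omega

/-- **The exceptional locus**: if `W/ℚ_p` (`p ≥ 5`) is elliptic with ADDITIVE minimal reduction and
has a `ℚ_p`-point `P ≠ O` with `p • P = O`, then `p = 5` and `‖c₄(W)‖ = 5⁻¹` (`v₅(c₄) = 1`,
Kodaira type II or III) or `p = 7` and `‖c₆(W)‖ = 7⁻¹` (`v₇(c₆) = 1`, Kodaira type II). Both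
cases occur over `ℚ` (`X₁(5)`, `X₁(7)`). [cite: Mazur1977, Ch. III §5, Step 1, p. 158] -/
theorem norm_c₄_or_norm_c₆_of_prime_zsmul_eq_zero (hp5 : 5 ≤ p)
    (W : WeierstrassCurve ℚ_[p]) [W.IsElliptic] [hadd : W.HasAdditiveReduction ℤ_[p]]
    {P : W.toAffine.Point} (hP0 : P ≠ 0) (hP : (p : ℤ) • P = 0) :
    (p = 5 ∧ ‖W.c₄‖ = (p : ℝ)⁻¹) ∨ (p = 7 ∧ ‖W.c₆‖ = (p : ℝ)⁻¹) := by
  obtain ⟨hc₄, hc₆, -⟩ := norm_c₄_c₆_Δ_lt_one W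
  by_contra hcon
  push Not at hcon
  refine not_prime_zsmul_eq_zero_of_hasAdditiveReduction' hp5 W (fun hp => ?_) (fun hp => ?_)
    hP0 hP
  · by_contra hlt
    exact hcon.1 hp (norm_eq_inv_of_lt_one_of_not_lt_inv hc₄ hlt)
  · by_contra hlt
    exact hcon.2 hp (norm_eq_inv_of_lt_one_of_not_lt_inv hc₆ hlt)

end Summit.BirchSwinnertonDyer.Rank1Residual.Additive.CuspTorsion

end
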